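import Literature.MathematicalPhysics.QuantumFieldTheory.BalabanImbrieJaffe1984to88.BIJ85CurlQsstar
import Literature.MathematicalPhysics.QuantumFieldTheory.BalabanImbrieJaffe1984to88.BIJ85Eq219ProofPart2
import Literature.MathematicalPhysics.QuantumFieldTheory.Balaban1983to89.B5Eq120IterProof

/-!
# `BalabanImbrieJaffe1984to88.BIJ85AxialEdgeRigidity` — T. Bałaban, J. Imbrie, A. Jaffe, *Renormalization of the Higgs
model: minimizers, propagators and the stability of mean field theory*, Commun. Math. Phys. **97** (1985) 299–329
[BalabanImbrieJaffe1985]: the block argument of Sect. 4.1 p. 309 ON THE TORI, one level, in a STRENGTHENED form —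
an axial bond field whose plaquette variables vanish off the edge plaquettes is the surface pull-back of its own block
average, `A = Q^{s*}(QA)` — PROVED

statement-level skeleton of published theorems with citation tags; proofs where landed; nothing here is a claim about the Yang–Mills mass gap

PDF held: `paper:balaban1985-cmp97-bij-higgs-minimizers` (journal page = PDF page + 298); p. 309 [PDF 11] read on the store's
text layer (`lit read … --pages 11`, lines 26–34).

THE PRINTED TEXT (p. 309, verbatim).  *"A proof of this fact for k = 1 follows by considering on each plaquette in a lattice
block the condition dA = 0 and the axial gauge condition. This shows that A can be nonzero only on bonds connecting different
blocks, and it must be constant on the bonds connecting two given blocks. The condition QA = 0 then ensures that A is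
everywhere zero."*

CITATION HEADER (lean-in-tree rule).  Phase-2 proof seat p33 (gen 2) of `lit-balaban` (HOME `run/shared/lean/pub/lit-balaban/`),
successor file of `…BIJ85NoZeroModes309Torus` (row **C1.Claim@309** on the torus), preparing the strict positivity of σ_k on the
tori (`…BIJ85SigmaPositivity`, rows **C1.Eq4.2.3** (partial) / **C1.Eq3.8**).  Carriers OF RECORD: the tori `Setup.Site P j` with
the block geometry of `Setup` (`blockOf`, `emb`, `Site.blockSite`), the lattice calculus `…Balaban1983to89.LatticeFieldCalculus`
(`curl c` = ∂ with lattice factor `c`, `segSum`, `stairSum`, the axial gauge `IsAxial` = (3.4), `bondAvg` = Q of (2.13)), the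
two-scale geometries `BIJ85Eq219Proof.torusBlockBonds` (surface bonds B^s(b′), `Qsstar` = Q^{s*} of (2.17)) and
`BIJ85CurlQsstar.torusEdgeCells` (edge plaquettes B^e(p′) of (2.21)).

WHAT IS PROVED.  The printed two steps, with the hypothesis dA = 0 required ONLY on the plaquettes inside a block (step 1) and on
the face plaquettes between two blocks (step 2) — i.e. on every plaquette that is not an edge plaquette; nothing is assumed on the
edge plaquettes B^e(p′), and QA is arbitrary:
* §1 — bookkeeping on block offsets `r : Fin d → Fin L` (`succOff`, `predOff`, `offLt`), the CORNER COMB potential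
  `combPot A y r = Σ_ν A([corner-comb segment of direction ν])` (forward straight runs inside `B(y)`, in the order of the axes) and
  its defect `combDefect`; the comb telescopes on comb-tree bonds (`combDefect_eq_zero_of_tree`) and the defect propagates across an
  interior plaquette by its plaquette variable (`combDefect_step`).
* §2 — STEP 1 (*"considering on each plaquette in a lattice block the condition dA = 0 … A can be nonzero only on bonds
  connecting different blocks"*): if `∂A = 0` on the interior plaquettes of `B(y)` then `A = ∂(comb potential)` on the interior bonds
  of `B(y)` (`apply_eq_combPot_sub`, a double induction on the direction and on the comb height), hence — with the axial gauge
  (3.4), by the telescoping of the centred staircases Γ_{y,x} (`B5Eq120IterProof.stairSum_grad`) which run inside `B(y)`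
  (`BIJ85Eq219ProofPart2.stairSum_eq_zero_of_interior`) — the potential is constant on `B(y)` and **A vanishes on every interior
  bond** (`apply_eq_zero_of_interior`).
* §3 — STEP 2 (*"it must be constant on the bonds connecting two given blocks"*): if moreover `∂A = 0` on the face plaquettes,
  A takes one value on the L^{d−1} surface bonds B^s(b′) of each coarse bond b′ (`apply_eq_apply_ref_of_face`).
* §4 — THE ONE-LEVEL RIGIDITY (`eq_Qsstar_bondAvg`): for `A` axial with `(∂A)(p) = 0` for every plaquette `p` outside all
  `B^e(p′)` — equivalently `∂A = Q^{e*}g` for some coarse plaquette field `g` (`eq_Qsstar_bondAvg_of_curl_eq_Qstar`) —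
  `A = Q^{s*}(QA)`; in particular (*"The condition QA = 0 then ensures that A is everywhere zero"*) `QA = 0 ⇒ A = 0`
  (`eq_zero_of_bondAvg_eq_zero`), the k = 1 claim of p. 309 with dA = 0 assumed off the edge plaquettes only.
Standing hypotheses: `j + 1 ≤ m + K` (block geometry of `Setup`), `2 ≤ d` (the edge-plaquette carrier), `c ≠ 0`.  No new
`def … : Prop`; the `def`s of §1 are plumbing with bodies.  Axioms: {propext, Classical.choice, Quot.sound}.
Unit `lit-balaban-p33` gen 2 (literature-prover-lit-balaban-p33-g2-0), 2026-08-21.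
-/

namespace Literature.MathematicalPhysics.QuantumFieldTheory.BalabanImbrieJaffe1984to88.BIJ85AxialEdgeRigidity

open Literature.MathematicalPhysics.QuantumFieldTheory.Balaban1983to89
open LatticeFieldCalculus BIJ85Sect2SurfaceAverages BIJ85CellAverages BIJ85Eq219Proof BIJ85Eq219ProofPart2 BIJ85CurlQsstar

noncomputable section

variable {P : Params} {j : ℕ}

/-! ## §0  Torus bookkeeping -/

/-- `y + e_μ ≠ y` on every torus of the series. [folklore] -/
private theorem shift_ne_self {k : ℕ} (y : Site P k) (μ : Fin P.d) : y.shift μ ≠ y := by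
  intro h
  have h1 := congrFun h μ
  simp only [Site.shift, Function.update_self] at h1
  exact one_ne_zero (add_eq_left.1 h1)

/-- Every fine site is a `blockSite` of its block (standing range). [folklore] -/
private theorem exists_eq_blockSite (hj : j + 1 ≤ P.m + P.K) (x : Site P j) :
    ∃ r : Fin P.d → Fin P.L, x = Site.blockSite (blockOf x) r := by
  refine ⟨Site.blockEquiv hj (blockOf x) ⟨x, rfl⟩, ?_⟩
  have h := (Site.blockEquiv hj (blockOf x)).symm_apply_apply ⟨x, rfl⟩
  exact (congrArg Subtype.val h).symm

/-- The axial gauge (3.4) asks `A(Γ_{y,x}) = 0` for `x ≠ y` only because `Γ_{y,y}` is empty: it holds for ALL block points.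
[cite: BalabanImbrieJaffe1985, (3.4) p.306] -/
theorem stairSum_eq_zero_of_isAxial {V : Type*} [AddCommGroup V] [Module ℝ V] {A : VecField P j V} (hA : IsAxial A)
    (y : Site P (j + 1)) (r : Fin P.d → Fin P.L) : stairSum A (emb y) (Site.blockSite y r) = 0 := by
  by_cases hc : Site.blockSite y r = emb y
  · rw [hc, stairSum_self]
  · exact hA y r hc

/-! ## §1  Block offsets, the corner comb and its defect -/

section Offsets

/-- the zero offset (the block corner). [folklore] -/
def zOff (P : Params) : Fin P.L := ⟨0, P.L_pos⟩

/-- one step forward in the direction `μ` (cyclically; used only while `r_μ + 1 < L`). [folklore] -/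
def succOff (r : Fin P.d → Fin P.L) (μ : Fin P.d) : Fin P.d → Fin P.L :=
  Function.update r μ ⟨((r μ : ℕ) + 1) % P.L, Nat.mod_lt _ P.L_pos⟩

/-- one step back in the direction `μ` (used only while `0 < r_μ`). [folklore] -/
def predOff (r : Fin P.d → Fin P.L) (μ : Fin P.d) : Fin P.d → Fin P.L :=
  Function.update r μ ⟨(r μ : ℕ) - 1, lt_of_le_of_lt (Nat.sub_le _ _) (r μ).isLt⟩

/-- the comb corner: coordinates `< n` from `r`, the others at the block corner. [folklore] -/
def offLt (r : Fin P.d → Fin P.L) (n : ℕ) : Fin P.d → Fin P.L := fun κ => if (κ : ℕ) < n then r κ else zOff P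

/-- value of `succOff` in the stepped coordinate while inside the block. [folklore] -/
private theorem succOff_apply_self {r : Fin P.d → Fin P.L} {μ : Fin P.d} (h : (r μ : ℕ) + 1 < P.L) :
    (succOff r μ μ : ℕ) = (r μ : ℕ) + 1 := by
  simp [succOff, Nat.mod_eq_of_lt h]

/-- `succOff` does not move the other coordinates. [folklore] -/
private theorem succOff_apply_ne (r : Fin P.d → Fin P.L) {μ κ : Fin P.d} (h : κ ≠ μ) : succOff r μ κ = r κ := by
  simp [succOff, Function.update_of_ne h]

/-- `succOff` is the `Function.update` used by `BIJ85CurlQsstar.shift_blockSite_of_lt`. [folklore] -/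
private theorem succOff_eq_update {r : Fin P.d → Fin P.L} {μ : Fin P.d} (h : (r μ : ℕ) + 1 < P.L) :
    succOff r μ = Function.update r μ ⟨(r μ : ℕ) + 1, h⟩ := by
  unfold succOff
  congr 1
  exact Fin.ext (Nat.mod_eq_of_lt h)

/-- `x + e_μ` for `x = blockSite y r` with `r_μ + 1 < L` is the block site with offset `succOff r μ`. [folklore] -/
private theorem shift_blockSite_eq_succOff (y : Site P (j + 1)) {r : Fin P.d → Fin P.L} {μ : Fin P.d} (h : (r μ : ℕ) + 1 < P.L) :
    (Site.blockSite y r).shift μ = Site.blockSite y (succOff r μ) := by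
  rw [shift_blockSite_of_lt y r μ h, succOff_eq_update h]

/-- value of `succOff` in the stepped coordinate (cyclic form). [folklore] -/
private theorem succOff_val_self (r : Fin P.d → Fin P.L) (μ : Fin P.d) : (succOff r μ μ : ℕ) = ((r μ : ℕ) + 1) % P.L := by
  simp [succOff]

/-- steps in different directions commute. [folklore] -/
private theorem succOff_comm (r : Fin P.d → Fin P.L) {μ ν : Fin P.d} (h : μ ≠ ν) :
    succOff (succOff r μ) ν = succOff (succOff r ν) μ := by
  funext κ
  apply Fin.ext
  by_cases hκμ : κ = μ
  · rw [hκμ, succOff_apply_ne _ h, succOff_val_self, succOff_val_self, succOff_apply_ne _ h]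
  · by_cases hκν : κ = ν
    · rw [hκν, succOff_apply_ne _ (Ne.symm h), succOff_val_self, succOff_val_self, succOff_apply_ne _ (Ne.symm h)]
    · rw [succOff_apply_ne _ hκν, succOff_apply_ne _ hκμ, succOff_apply_ne _ hκμ, succOff_apply_ne _ hκν]

/-- `predOff` then `succOff` is the identity when `0 < r_μ`. [folklore] -/
private theorem succOff_predOff {r : Fin P.d → Fin P.L} {μ : Fin P.d} (h : 0 < (r μ : ℕ)) : succOff (predOff r μ) μ = r := by
  funext κ
  by_cases hκ : κ = μ
  · subst hκ
    apply Fin.ext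
    have := (r κ).isLt
    simp only [succOff, predOff, Function.update_self]
    rw [show (r κ : ℕ) - 1 + 1 = (r κ : ℕ) by omega, Nat.mod_eq_of_lt this]
  · simp [succOff, predOff, Function.update_of_ne hκ]

/-- `predOff` in the stepped coordinate. [folklore] -/
private theorem predOff_apply_self (r : Fin P.d → Fin P.L) (μ : Fin P.d) : (predOff r μ μ : ℕ) = (r μ : ℕ) - 1 := by
  simp [predOff]

/-- `predOff` does not move the other coordinates. [folklore] -/
private theorem predOff_apply_ne (r : Fin P.d → Fin P.L) {μ κ : Fin P.d} (h : κ ≠ μ) : predOff r μ κ = r κ := by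
  simp [predOff, Function.update_of_ne h]

end Offsets

section Comb

variable (A : VecField P j ℝ) (y : Site P (j + 1))

/-- THE CORNER COMB POTENTIAL: the sum of `A` along the comb from the block corner `blockSite y 0` to `blockSite y r` which raises
the coordinates in the order of the axes — the straight run of direction `ν` has length `r_ν` and starts at the comb corner
`offLt r ν` (forward runs only, all inside `B(y)`). [cite: BalabanImbrieJaffe1985, §4.1 p.309] -/
def combPot (r : Fin P.d → Fin P.L) : ℝ :=
  ∑ ν : Fin P.d, segSum A (Site.blockSite y (offLt r ν)) ν (r ν)

/-- THE DEFECT of the comb potential on the bond `⟨blockSite y r, μ⟩`: `A − ∂(combPot)` there. [cite: BalabanImbrieJaffe1985, §4.1 p.309] -/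
def combDefect (r : Fin P.d → Fin P.L) (μ : Fin P.d) : ℝ :=
  A ⟨Site.blockSite y r, μ⟩ - (combPot A y (succOff r μ) - combPot A y r)

/-- The comb TELESCOPES on comb-tree bonds: if the coordinates of `r` above `μ` vanish (and `r_μ + 1 < L`) then
`combPot (r + e_μ) − combPot r = A⟨blockSite y r, μ⟩`, i.e. the defect vanishes. [cite: BalabanImbrieJaffe1985, §4.1 p.309] -/
theorem combDefect_eq_zero_of_tree {r : Fin P.d → Fin P.L} {μ : Fin P.d} (h : (r μ : ℕ) + 1 < P.L)
    (hr : ∀ κ : Fin P.d, μ < κ → r κ = zOff P) : combDefect A y r μ = 0 := by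
  unfold combDefect combPot
  rw [← Finset.sum_sub_distrib, Finset.sum_eq_single μ]
  · -- the run of direction μ gains exactly the bond ⟨blockSite y r, μ⟩
    have hstart : offLt (succOff r μ) μ = offLt r μ := by
      funext κ
      by_cases hκ : (κ : ℕ) < μ
      · have hne : κ ≠ μ := fun h' => by subst h'; exact lt_irrefl _ hκ
        simp [offLt, hκ, succOff_apply_ne r hne]
      · simp [offLt, hκ]
    have hlen : (succOff r μ μ : ℕ) = (r μ : ℕ) + 1 := succOff_apply_self h
    rw [hstart, hlen, segSum, segSum, Finset.sum_range_succ, add_sub_cancel_left]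
    -- the gained bond
    have h0 : ((offLt r μ) μ : ℕ) + (r μ : ℕ) < P.L := by
      have h1 : (offLt r μ μ : ℕ) = 0 := by simp [offLt, zOff]
      have := (r μ).isLt
      omega
    have hsite : runSite (Site.blockSite y (offLt r μ)) μ (r μ) = Site.blockSite y r := by
      rw [runSite_blockSite_of_lt y (offLt r μ) μ h0]
      congr 1
      funext κ
      by_cases hκ : κ = μ
      · subst hκ
        rw [Function.update_self]
        exact Fin.ext (by simp [offLt, zOff])
      · rw [Function.update_of_ne hκ]
        by_cases hlt : (κ : ℕ) < μ
        · simp [offLt, hlt]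
        · have hgt : μ < κ := by
            rw [Fin.lt_def]
            have := Fin.val_injective.ne hκ
            omega
          simp [offLt, hlt, hr κ hgt]
    rw [runBond, hsite, sub_self]
  · -- the other runs are unchanged
    intro ν _ hν
    by_cases hlt : ν < μ
    · have hstart : offLt (succOff r μ) ν = offLt r ν := by
        funext κ
        by_cases hκ : (κ : ℕ) < ν
        · have hne : κ ≠ μ := fun h' => by subst h'; exact lt_asymm hlt (Fin.lt_def.2 hκ)
          simp [offLt, hκ, succOff_apply_ne r hne]
        · simp [offLt, hκ]
      rw [hstart, succOff_apply_ne r hν, sub_self]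
    · have hgt : μ < ν := lt_of_le_of_ne (not_lt.1 hlt) (Ne.symm hν)
      have h1 : (r ν : ℕ) = 0 := by rw [hr ν hgt]; rfl
      have h2 : (succOff r μ ν : ℕ) = 0 := by rw [succOff_apply_ne r hν, hr ν hgt]; rfl
      simp [segSum, h1, h2]
  · intro h'; exact absurd (Finset.mem_univ μ) h'

/-- THE DEFECT PROPAGATES ACROSS A PLAQUETTE: for an interior plaquette `⟨blockSite y r, μ, ν⟩` (`r_μ + 1 < L`, `r_ν + 1 < L`),
`D(r + e_ν, μ) = D(r, μ) + D(r + e_μ, ν) − D(r, ν) − c⁻¹(∂A)(p)` — the plaquette identity with the potential terms cancelled.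
[cite: BalabanImbrieJaffe1985, §4.1 p.309] -/
theorem combDefect_step {c : ℝ} (hc : c ≠ 0) {r : Fin P.d → Fin P.L} {μ ν : Fin P.d} (hμν : μ < ν)
    (hμ : (r μ : ℕ) + 1 < P.L) (hν : (r ν : ℕ) + 1 < P.L) :
    combDefect A y (succOff r ν) μ =
      combDefect A y r μ + combDefect A y (succOff r μ) ν - combDefect A y r ν
        - c⁻¹ * curl c A ⟨Site.blockSite y r, μ, ν, hμν⟩ := by
  have hne : μ ≠ ν := ne_of_lt hμν
  have hcurl : curl c A ⟨Site.blockSite y r, μ, ν, hμν⟩ =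
      c * (A ⟨Site.blockSite y r, μ⟩ + A ⟨Site.blockSite y (succOff r μ), ν⟩
        - A ⟨Site.blockSite y (succOff r ν), μ⟩ - A ⟨Site.blockSite y r, ν⟩) := by
    simp only [curl, smul_eq_mul]
    rw [shift_blockSite_eq_succOff y hμ, shift_blockSite_eq_succOff y hν]
  unfold combDefect
  rw [hcurl, succOff_comm r hne.symm]
  field_simp
  ring

end Comb

/-! ## §2  Step 1: inside a block, dA = 0 and the axial gauge kill A -/

section Interior

variable {A : VecField P j ℝ} {y : Site P (j + 1)} {c : ℝ}

/-- An interior plaquette of `B(y)` is not an edge plaquette. [cite: BalabanImbrieJaffe1985, (2.21) p.305] -/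
theorem not_mem_edgeB_of_lt (hj : j + 1 ≤ P.m + P.K) (hd : 2 ≤ P.d) (y : Site P (j + 1)) (r : Fin P.d → Fin P.L)
    {μ ν : Fin P.d} (hμν : μ < ν) (h : (r μ : ℕ) + 1 < P.L ∨ (r ν : ℕ) + 1 < P.L) (p' : Plaq P (j + 1)) :
    (⟨Site.blockSite y r, μ, ν, hμν⟩ : Plaq P j) ∉ (torusEdgeCells P j hd).B p' := by
  intro hp
  obtain ⟨-, h1, h2⟩ := (mem_edgeB_blockSite_iff hj hd p' y r hμν).mp hp
  omega

/-- STEP 1, the potential: if `∂A` vanishes on the interior plaquettes of `B(y)` then on every interior bond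
`A⟨blockSite y r, μ⟩ = combPot(r + e_μ) − combPot(r)` — by a double induction (directions from the last one down; for a fixed
direction, on the comb height `Σ_{κ>μ} r_κ`, one interior plaquette at a time, `combDefect_step`). [cite: BalabanImbrieJaffe1985, §4.1 p.309] -/
theorem combDefect_eq_zero (hc : c ≠ 0)
    (hcurl : ∀ (r : Fin P.d → Fin P.L) (μ ν : Fin P.d) (hμν : μ < ν), (r μ : ℕ) + 1 < P.L → (r ν : ℕ) + 1 < P.L →
      curl c A ⟨Site.blockSite y r, μ, ν, hμν⟩ = 0) :
    ∀ (μ : Fin P.d) (r : Fin P.d → Fin P.L), (r μ : ℕ) + 1 < P.L → combDefect A y r μ = 0 := by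
  -- outer induction: on `m = d − 1 − μ` (directions from the top)
  suffices H : ∀ m : ℕ, ∀ μ : Fin P.d, P.d - 1 - (μ : ℕ) = m →
      ∀ r : Fin P.d → Fin P.L, (r μ : ℕ) + 1 < P.L → combDefect A y r μ = 0 from
    fun μ r h => H _ μ rfl r h
  intro m
  induction m using Nat.strong_induction_on with
  | _ m IHm =>
    intro μ hm
    -- inner induction: on the comb height above μ
    suffices H' : ∀ n : ℕ, ∀ r : Fin P.d → Fin P.L, (∑ κ : Fin P.d, if μ < κ then (r κ : ℕ) else 0) = n →
        (r μ : ℕ) + 1 < P.L → combDefect A y r μ = 0 from fun r h => H' _ r rfl h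
    intro n
    induction n with
    | zero =>
      intro r hsum h
      apply combDefect_eq_zero_of_tree A y h
      intro κ hκ
      have h0 : (if μ < κ then (r κ : ℕ) else 0) = 0 :=
        (Finset.sum_eq_zero_iff.mp hsum) κ (Finset.mem_univ κ)
      rw [if_pos hκ] at h0
      exact Fin.ext h0
    | succ n IHn =>
      intro r hsum h
      -- a direction ν > μ with r_ν > 0
      obtain ⟨ν, hμν, hν0⟩ : ∃ ν : Fin P.d, μ < ν ∧ 0 < (r ν : ℕ) := by
        by_contra hno
        push Not at hno
        have : (∑ κ : Fin P.d, if μ < κ then (r κ : ℕ) else 0) = 0 := by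
          refine Finset.sum_eq_zero fun κ _ => ?_
          by_cases hκ : μ < κ
          · rw [if_pos hκ]; exact Nat.le_zero.mp (hno κ hκ)
          · rw [if_neg hκ]
        omega
      have hne : μ ≠ ν := ne_of_lt hμν
      -- r = r' + e_ν
      set r' := predOff r ν with hr'
      have hrr' : r = succOff r' ν := (succOff_predOff hν0).symm
      have hr'μ : (r' μ : ℕ) + 1 < P.L := by rw [hr', predOff_apply_ne r hne]; exact h
      have hr'ν : (r' ν : ℕ) + 1 < P.L := by rw [hr', predOff_apply_self]; have := (r ν).isLt; omega
      have hsum' : (∑ κ : Fin P.d, if μ < κ then (r' κ : ℕ) else 0) = n := by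
        have hsplit : ∀ s : Fin P.d → Fin P.L, (∑ κ : Fin P.d, if μ < κ then (s κ : ℕ) else 0) =
            (if μ < ν then (s ν : ℕ) else 0) + ∑ κ ∈ Finset.univ.erase ν, if μ < κ then (s κ : ℕ) else 0 :=
          fun s => (Finset.add_sum_erase _ _ (Finset.mem_univ ν)).symm
        have hrest : (∑ κ ∈ Finset.univ.erase ν, if μ < κ then (r' κ : ℕ) else 0) =
            ∑ κ ∈ Finset.univ.erase ν, if μ < κ then (r κ : ℕ) else 0 := by
          refine Finset.sum_congr rfl fun κ hκ => ?_
          rw [hr', predOff_apply_ne r (Finset.ne_of_mem_erase hκ)]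
        rw [hsplit] at hsum ⊢
        rw [hrest, if_pos hμν, hr', predOff_apply_self]
        rw [if_pos hμν] at hsum
        omega
      -- the three other defects of the plaquette at r' vanish
      have h1 : combDefect A y r' μ = 0 := IHn r' hsum' hr'μ
      have hmν : P.d - 1 - (ν : ℕ) < m := by
        have := ν.isLt
        have := Fin.lt_def.1 hμν
        omega
      have h2 : combDefect A y (succOff r' μ) ν = 0 :=
        IHm _ hmν ν rfl (succOff r' μ) (by rw [succOff_apply_ne r' hne.symm]; exact hr'ν)
      have h3 : combDefect A y r' ν = 0 := IHm _ hmν ν rfl r' hr'ν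
      rw [hrr', combDefect_step A y hc hμν hr'μ hr'ν, h1, h2, h3, hcurl r' μ ν hμν hr'μ hr'ν]
      ring

/-- STEP 1 on the interior bonds, potential form: `A⟨blockSite y r, μ⟩ = combPot(r + e_μ) − combPot(r)` for `r_μ + 1 < L`.
[cite: BalabanImbrieJaffe1985, §4.1 p.309] -/
theorem apply_eq_combPot_sub (hc : c ≠ 0)
    (hcurl : ∀ (r : Fin P.d → Fin P.L) (μ ν : Fin P.d) (hμν : μ < ν), (r μ : ℕ) + 1 < P.L → (r ν : ℕ) + 1 < P.L →
      curl c A ⟨Site.blockSite y r, μ, ν, hμν⟩ = 0)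
    (r : Fin P.d → Fin P.L) (μ : Fin P.d) (h : (r μ : ℕ) + 1 < P.L) :
    A ⟨Site.blockSite y r, μ⟩ = combPot A y (succOff r μ) - combPot A y r := by
  have := combDefect_eq_zero hc hcurl μ r h
  unfold combDefect at this
  linarith

/-- The comb potential as a site function on the whole torus (zero off `B(y)`; on `B(y)` the block site `blockSite y r` ↦ `combPot r`).
[cite: BalabanImbrieJaffe1985, §4.1 p.309] -/
def combPotField (hj : j + 1 ≤ P.m + P.K) (A : VecField P j ℝ) (y : Site P (j + 1)) : SiteField P j ℝ :=
  fun x => if h : blockOf x = y then combPot A y (Site.blockEquiv hj y ⟨x, h⟩) else 0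

/-- Its value at a block site. [cite: BalabanImbrieJaffe1985, §4.1 p.309] -/
theorem combPotField_blockSite (hj : j + 1 ≤ P.m + P.K) (A : VecField P j ℝ) (y : Site P (j + 1)) (r : Fin P.d → Fin P.L) :
    combPotField hj A y (Site.blockSite y r) = combPot A y r := by
  unfold combPotField
  rw [dif_pos (Site.blockOf_blockSite hj y r)]
  congr 1
  exact (Site.blockEquiv hj y).apply_symm_apply r

/-- STEP 1 (*"A can be nonzero only on bonds connecting different blocks"*): an AXIAL field whose plaquette variables vanish on the
interior plaquettes of `B(y)` vanishes on every interior bond of `B(y)` — the comb potential is constant on `B(y)` because the centred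
staircases `Γ_{y,x}` run inside the block and `A(Γ_{y,x}) = 0` (standing range, `c ≠ 0`). [cite: BalabanImbrieJaffe1985, §4.1 p.309] -/
theorem apply_eq_zero_of_interior (hj : j + 1 ≤ P.m + P.K) (hc : c ≠ 0) (hAx : IsAxial A)
    (hcurl : ∀ (r : Fin P.d → Fin P.L) (μ ν : Fin P.d) (hμν : μ < ν), (r μ : ℕ) + 1 < P.L → (r ν : ℕ) + 1 < P.L →
      curl c A ⟨Site.blockSite y r, μ, ν, hμν⟩ = 0)
    (r : Fin P.d → Fin P.L) (μ : Fin P.d) (h : (r μ : ℕ) + 1 < P.L) : A ⟨Site.blockSite y r, μ⟩ = 0 := by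
  set φ := combPotField hj A y with hφ
  -- A − ∂φ vanishes on the interior bonds of B(y)
  have hint : ∀ b : PBond P j, blockOf b.src = y → blockOf b.tgt = y → (fun b' => A b' - grad 1 φ b') b = 0 := by
    intro b hs ht
    obtain ⟨x, κ⟩ := b
    obtain ⟨s, hs'⟩ := exists_eq_blockSite hj x
    simp only at hs ht hs'
    rw [hs] at hs'
    subst hs'
    have hlt : (s κ : ℕ) + 1 < P.L := by
      by_contra hge
      have heq : (s κ : ℕ) + 1 = P.L := by have := (s κ).isLt; omega
      have h' : blockOf ((Site.blockSite y s).shift κ) = y.shift κ := by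
        rw [blockOf_shift_blockSite hj, if_pos heq]
      exact shift_ne_self y κ (h'.symm.trans ht)
    simp only [grad, PBond.tgt]
    rw [one_smul, shift_blockSite_eq_succOff y hlt, hφ, combPotField_blockSite, combPotField_blockSite,
      apply_eq_combPot_sub hc hcurl s κ hlt, sub_self]
  -- hence A(Γ_{y,x}) = φ(x) − φ(y) for every x ∈ B(y), and the axial gauge makes φ constant on B(y)
  have hconst : ∀ s : Fin P.d → Fin P.L, combPot A y s = φ (emb y) := by
    intro s
    have h0 := stairSum_eq_zero_of_interior hj (A := fun b' => A b' - grad 1 φ b') y hint s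
    rw [B5Eq120IterProof.stairSum_sub, stairSum_eq_zero_of_isAxial hAx, zero_sub, neg_eq_zero,
      B5Eq120IterProof.stairSum_grad, one_smul, sub_eq_zero, hφ, combPotField_blockSite] at h0
    rw [hφ]; exact h0
  rw [apply_eq_combPot_sub hc hcurl r μ h, hconst, hconst, sub_self]

end Interior

/-! ## §3  Step 2: A is constant on the bonds connecting two given blocks -/

section Face

variable {A : VecField P j ℝ} {c : ℝ}

/-- the reference surface bond of the face of `B(y)` in the direction `μ`: offsets `L − 1` in `μ`, `0` elsewhere. [folklore] -/
def refOff (P : Params) (μ : Fin P.d) : Fin P.d → Fin P.L :=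
  Function.update (fun _ => zOff P) μ ⟨P.L - 1, by have := P.hL.2; omega⟩

/-- STEP 2, one face plaquette: for a surface bond `⟨blockSite y r, μ⟩` (`r_μ = L − 1`) and a direction `ν ≠ μ` with `r_ν + 1 < L`, the
plaquette through `⟨blockSite y r, μ⟩` and `⟨blockSite y (r + e_ν), μ⟩` is a face plaquette (not an edge plaquette); its two other bonds
are interior to `B(y)` and to `B(y + e_μ)` and vanish by Step 1, so dA = 0 on it equates the two surface values.
[cite: BalabanImbrieJaffe1985, §4.1 p.309] -/
theorem apply_eq_apply_succOff_of_face (hj : j + 1 ≤ P.m + P.K) (hd : 2 ≤ P.d) (hc : c ≠ 0) (hAx : IsAxial A)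
    (hcurl : ∀ p : Plaq P j, (∀ p' : Plaq P (j + 1), p ∉ (torusEdgeCells P j hd).B p') → curl c A p = 0)
    (y : Site P (j + 1)) {r : Fin P.d → Fin P.L} {μ ν : Fin P.d} (hμ : (r μ : ℕ) + 1 = P.L) (hne : ν ≠ μ)
    (hν : (r ν : ℕ) + 1 < P.L) :
    A ⟨Site.blockSite y r, μ⟩ = A ⟨Site.blockSite y (succOff r ν), μ⟩ := by
  -- Step 1 is available in every block
  have hint : ∀ (y' : Site P (j + 1)) (s : Fin P.d → Fin P.L) (κ : Fin P.d), (s κ : ℕ) + 1 < P.L →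
      A ⟨Site.blockSite y' s, κ⟩ = 0 := fun y' s κ hκ =>
    apply_eq_zero_of_interior hj hc hAx
      (fun s' α β hαβ hα _ => hcurl _ (not_mem_edgeB_of_lt hj hd y' s' hαβ (Or.inl hα))) s κ hκ
  -- the two interior bonds of the face plaquette
  have hin1 : A ⟨Site.blockSite y r, ν⟩ = 0 := hint y r ν hν
  have hin2 : A ⟨(Site.blockSite y r).shift μ, ν⟩ = 0 := by
    rw [shift_blockSite_of_eq hj y r μ hμ]
    exact hint _ _ ν (by rw [Function.update_of_ne hne]; exact hν)
  rcases lt_or_gt_of_ne hne with hνμ | hμν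
  · -- the plaquette ⟨x, ν, μ⟩
    have h0 := hcurl ⟨Site.blockSite y r, ν, μ, hνμ⟩ (not_mem_edgeB_of_lt hj hd y r hνμ (Or.inl hν))
    simp only [curl, smul_eq_mul] at h0
    rw [hin1, hin2, shift_blockSite_eq_succOff y hν] at h0
    have := (mul_eq_zero.1 h0).resolve_left hc
    linarith
  · -- the plaquette ⟨x, μ, ν⟩
    have h0 := hcurl ⟨Site.blockSite y r, μ, ν, hμν⟩ (not_mem_edgeB_of_lt hj hd y r hμν (Or.inr hν))
    simp only [curl, smul_eq_mul] at h0
    rw [hin1, hin2, shift_blockSite_eq_succOff y hν] at h0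
    have := (mul_eq_zero.1 h0).resolve_left hc
    linarith

/-- STEP 2 (*"it must be constant on the bonds connecting two given blocks"*): all the surface bonds of the face of `B(y)` towards
`B(y + e_μ)` carry the value of the reference bond `⟨blockSite y (refOff μ), μ⟩` (induction on the total offset along the face).
[cite: BalabanImbrieJaffe1985, §4.1 p.309] -/
theorem apply_eq_apply_ref_of_face (hj : j + 1 ≤ P.m + P.K) (hd : 2 ≤ P.d) (hc : c ≠ 0) (hAx : IsAxial A)
    (hcurl : ∀ p : Plaq P j, (∀ p' : Plaq P (j + 1), p ∉ (torusEdgeCells P j hd).B p') → curl c A p = 0)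
    (y : Site P (j + 1)) {r : Fin P.d → Fin P.L} {μ : Fin P.d} (hμ : (r μ : ℕ) + 1 = P.L) :
    A ⟨Site.blockSite y r, μ⟩ = A ⟨Site.blockSite y (refOff P μ), μ⟩ := by
  suffices H : ∀ n : ℕ, ∀ r : Fin P.d → Fin P.L, (∑ κ ∈ Finset.univ.erase μ, (r κ : ℕ)) = n → (r μ : ℕ) + 1 = P.L →
      A ⟨Site.blockSite y r, μ⟩ = A ⟨Site.blockSite y (refOff P μ), μ⟩ from H _ r rfl hμ
  intro n
  induction n with
  | zero =>
    intro r hsum hμ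
    have hr : r = refOff P μ := by
      funext κ
      by_cases hκ : κ = μ
      · subst hκ
        apply Fin.ext
        simp only [refOff, Function.update_self]
        omega
      · have h0 : (r κ : ℕ) = 0 := (Finset.sum_eq_zero_iff.mp hsum) κ (Finset.mem_erase.mpr ⟨hκ, Finset.mem_univ κ⟩)
        rw [refOff, Function.update_of_ne hκ]
        exact Fin.ext h0
    rw [hr]
  | succ n IH =>
    intro r hsum hμ
    obtain ⟨ν, hne, hν0⟩ : ∃ ν : Fin P.d, ν ≠ μ ∧ 0 < (r ν : ℕ) := by
      by_contra hno
      push Not at hno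
      have : (∑ κ ∈ Finset.univ.erase μ, (r κ : ℕ)) = 0 :=
        Finset.sum_eq_zero fun κ hκ => Nat.le_zero.mp (hno κ (Finset.ne_of_mem_erase hκ))
      omega
    set r' := predOff r ν with hr'
    have hrr' : r = succOff r' ν := (succOff_predOff hν0).symm
    have hr'μ : (r' μ : ℕ) + 1 = P.L := by rw [hr', predOff_apply_ne r hne.symm]; exact hμ
    have hr'ν : (r' ν : ℕ) + 1 < P.L := by rw [hr', predOff_apply_self]; have := (r ν).isLt; omega
    have hsum' : (∑ κ ∈ Finset.univ.erase μ, (r' κ : ℕ)) = n := by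
      have hmem : ν ∈ Finset.univ.erase μ := Finset.mem_erase.mpr ⟨hne, Finset.mem_univ ν⟩
      have hsplit : ∀ s : Fin P.d → Fin P.L, (∑ κ ∈ Finset.univ.erase μ, (s κ : ℕ)) =
          (s ν : ℕ) + ∑ κ ∈ (Finset.univ.erase μ).erase ν, (s κ : ℕ) :=
        fun s => (Finset.add_sum_erase _ _ hmem).symm
      have hrest : (∑ κ ∈ (Finset.univ.erase μ).erase ν, (r' κ : ℕ)) = ∑ κ ∈ (Finset.univ.erase μ).erase ν, (r κ : ℕ) := by
        refine Finset.sum_congr rfl fun κ hκ => ?_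
        rw [hr', predOff_apply_ne r (Finset.ne_of_mem_erase hκ)]
      rw [hsplit] at hsum ⊢
      rw [hrest, hr', predOff_apply_self]
      omega
    rw [hrr', ← apply_eq_apply_succOff_of_face hj hd hc hAx hcurl y hr'μ hne hr'ν]
    exact IH r' hsum' hr'μ

end Face

/-! ## §4  The one-level rigidity: A = Q^{s*}(QA) -/

section Rigidity

variable {A : VecField P j ℝ} {c : ℝ}

/-- **THE ONE-LEVEL RIGIDITY** (p. 309's block argument with dA = 0 assumed OFF THE EDGE PLAQUETTES ONLY): an axial bond field
`A` on `T^{(j)}` whose plaquette variables vanish on every plaquette outside all `B^e(p′)` is the surface pull-back (2.17) of its own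
block average (2.13): `A = Q^{s*}(QA)` — it vanishes on interior bonds (Step 1) and is constant on each face (Step 2), and such a
field is `Q^{s*}F′` with `F′ = Q(Q^{s*}F′) = QA` by (2.19) (standing range, `2 ≤ d`, `c ≠ 0`). [cite: BalabanImbrieJaffe1985, §4.1 p.309] -/
theorem eq_Qsstar_bondAvg (hj : j + 1 ≤ P.m + P.K) (hd : 2 ≤ P.d) (hc : c ≠ 0) (hAx : IsAxial A)
    (hcurl : ∀ p : Plaq P j, (∀ p' : Plaq P (j + 1), p ∉ (torusEdgeCells P j hd).B p') → curl c A p = 0) :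
    A = (torusBlockBonds P j).Qsstar (bondAvg A) := by
  have hL : (P.L : ℝ) ≠ 0 := Nat.cast_ne_zero.mpr P.L_pos.ne'
  -- the coarse field of face values
  set F' : PBond P (j + 1) → ℝ := fun b' => (P.L : ℝ)⁻¹ * A ⟨Site.blockSite b'.src (refOff P b'.dir), b'.dir⟩ with hF'
  have hA : A = (torusBlockBonds P j).Qsstar F' := by
    funext b
    obtain ⟨x, κ⟩ := b
    obtain ⟨r, hr⟩ := exists_eq_blockSite hj x
    rw [hr, Qsstar_blockSite hj]
    split_ifs with h
    · rw [apply_eq_apply_ref_of_face hj hd hc hAx hcurl (blockOf x) h, hF']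
      simp only
      rw [← mul_assoc, mul_inv_cancel₀ hL, one_mul]
    · exact apply_eq_zero_of_interior hj hc hAx
        (fun s α β hαβ hα _ => hcurl _ (not_mem_edgeB_of_lt hj hd _ s hαβ (Or.inl hα))) r κ
        (by have := (r κ).isLt; omega)
  have hQ : bondAvg A = F' := by rw [hA, bondAvg_Qsstar hj]
  rw [hQ]
  exact hA

/-- The same with the hypothesis in operator form: `∂A = Q^{e*}g` for some coarse plaquette field `g` (then `∂A` vanishes off the
edge plaquettes by (2.22)). [cite: BalabanImbrieJaffe1985, §4.1 p.309] -/
theorem eq_Qsstar_bondAvg_of_curl_eq_Qstar (hj : j + 1 ≤ P.m + P.K) (hd : 2 ≤ P.d) (hc : c ≠ 0) (hAx : IsAxial A)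
    (g : Plaq P (j + 1) → ℝ) (hcurl : curl c A = (torusEdgeCells P j hd).Qstar g) :
    A = (torusBlockBonds P j).Qsstar (bondAvg A) :=
  eq_Qsstar_bondAvg hj hd hc hAx fun p hp => by
    rw [hcurl]
    exact (torusEdgeCells P j hd).Qstar_of_not_mem g hp

/-- **The k = 1 claim of p. 309, strengthened** (*"The condition QA = 0 then ensures that A is everywhere zero"*): an axial field with
`QA = 0` whose plaquette variables vanish off the edge plaquettes vanishes identically. [cite: BalabanImbrieJaffe1985, §4.1 p.309] -/
theorem eq_zero_of_bondAvg_eq_zero (hj : j + 1 ≤ P.m + P.K) (hd : 2 ≤ P.d) (hc : c ≠ 0) (hAx : IsAxial A)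
    (hcurl : ∀ p : Plaq P j, (∀ p' : Plaq P (j + 1), p ∉ (torusEdgeCells P j hd).B p') → curl c A p = 0)
    (hQ : bondAvg A = 0) : A = 0 := by
  rw [eq_Qsstar_bondAvg hj hd hc hAx hcurl, hQ]
  funext b
  by_cases h : ∃ b', b ∈ (torusBlockBonds P j).Bs b'
  · obtain ⟨b', hb'⟩ := h
    rw [(torusBlockBonds P j).Qsstar_of_mem 0 hb']
    simp
  · push Not at h
    rw [(torusBlockBonds P j).Qsstar_of_not_mem 0 h]
    rfl

end Rigidity

end

end Literature.MathematicalPhysics.QuantumFieldTheory.BalabanImbrieJaffe1984to88.BIJ85AxialEdgeRigidity
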